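import Summits.MatrixMultiplication.OmegaCensus.DominoZ29StructFiveRowsB
import HarnessLib

/-!
# Structural part-`5` route at `p = 29`: rows `14`–`20` of the completeness check (file 3 of 4)

See `DominoZ29StructFiveRowsA.lean` (split rationale) and `DominoZ29Z29StructFiveCells.lean` (the cell theorems).  ω-census `pub-omega`, family (b3), seat
pub-omega-group gen 23; framing: lottery ticket, floor = certified bounds/negative ranges; NOT progress on ω.
-/

namespace Summit.MatrixMultiplication.OmegaCensus

open Finset ZpZpDomino Literature.Combinatorics.Additive

namespace ZpZpDomino

set_option maxHeartbeats 4000000 in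
/-- Row `b = 14` of the completeness check (`29²` lookups). [folklore] -/
theorem checkFiveRow_29_14 : checkFiveRow 29 ecZ29s5 tabTreeZ29s5 14 = true := by decide +kernel

set_option maxHeartbeats 4000000 in
/-- Row `b = 15` of the completeness check (`29²` lookups). [folklore] -/
theorem checkFiveRow_29_15 : checkFiveRow 29 ecZ29s5 tabTreeZ29s5 15 = true := by decide +kernel

set_option maxHeartbeats 4000000 in
/-- Row `b = 16` of the completeness check (`29²` lookups). [folklore] -/
theorem checkFiveRow_29_16 : checkFiveRow 29 ecZ29s5 tabTreeZ29s5 16 = true := by decide +kernel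

set_option maxHeartbeats 4000000 in
/-- Row `b = 17` of the completeness check (`29²` lookups). [folklore] -/
theorem checkFiveRow_29_17 : checkFiveRow 29 ecZ29s5 tabTreeZ29s5 17 = true := by decide +kernel

set_option maxHeartbeats 4000000 in
/-- Row `b = 18` of the completeness check (`29²` lookups). [folklore] -/
theorem checkFiveRow_29_18 : checkFiveRow 29 ecZ29s5 tabTreeZ29s5 18 = true := by decide +kernel

set_option maxHeartbeats 4000000 in
/-- Row `b = 19` of the completeness check (`29²` lookups). [folklore] -/
theorem checkFiveRow_29_19 : checkFiveRow 29 ecZ29s5 tabTreeZ29s5 19 = true := by decide +kernel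

set_option maxHeartbeats 4000000 in
/-- Row `b = 20` of the completeness check (`29²` lookups). [folklore] -/
theorem checkFiveRow_29_20 : checkFiveRow 29 ecZ29s5 tabTreeZ29s5 20 = true := by decide +kernel


end ZpZpDomino

end Summit.MatrixMultiplication.OmegaCensus
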